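import Summits.QuantumFields.YangMills.Theorems.InfiniteVolumeMomentBoundsOnSides
import Literature.MathematicalPhysics.QuantumLattice.LatticeGaugeDLRGibbsProofs
import HarnessLib

/-!
# Route `InfiniteVolumeContinuum` ∕ crux `UVSeamRec` (E0′ half): shape (T) of the torus-parity crossing AT THE
# INFINITE-VOLUME LEVEL — class ceilings + uniqueness of the thermodynamic limit ⇒ the DLR ∕ IV ∕ TL ceilings

Seat `ym-infvol-p1` (R136 (i); the seat that typed `MomentBounds6TL ∕ IV ∕ DLR`, p454931).  HONEST FRAMING: a
CONDITIONAL, kernel-checked soft lemma.  BOTH hypotheses are OPEN at weak coupling: the class ceilings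
`TorusClass.MomentBounds6OnSides G r a 𝓣` (E0′ on the tori of an unbounded class of raw sides — e.g. Track A's even
family `2·Lⁿ`; owed by the spine's `UVSeamRec`∕Track A) and UNIQUENESS of the infinite-volume limit
(`HasUniqueInfiniteVolumeLimit r.ρ β`, resp. `(ymGibbsMeasures r.ρ β).Subsingleton`, for `β ≥ β₀` — proved in the
tree only at STRONG coupling, `InfiniteVolumeSufficientX.hasUniqueInfiniteVolumeLimit_SU_strongCoupling`; at weak
coupling it is an infrared statement of the calibre of the spine's `IR`).  Nothing about Yang–Mills is asserted
unconditionally; not a gap, not Clay.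

WHY (route owner ym-beyond-p2 g21, `RULING-parity-S0-g21.md` 8ff405341f995f0e, R4 shape (T): «even-family Gibbs
ceilings + a NAMED infinite-volume uniqueness ∕ strong-mixing hypothesis ⇒ ceilings on all LARGE odd tori», admissible
only with the uniqueness hypothesis as its own named dependency and with a weakened finite-torus currency
`MomentBounds6Large`).  LOCATED REMARK this file makes precise: at the level the infinite-volume-first route CONSUMES
the ceilings (limit states, `MomentBounds6TL`), shape (T) needs NO weakened currency and NO bridge-threshold check —
uniqueness alone identifies every torus limit state (odd or even subsequence) with THE limit, to which the class
ceilings pass with the same constants (seat p2's `momentBounds6On_of_onSides`).  What uniqueness does NOT give is the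
spine's FINITE odd-torus currency `MomentBounds6` (or any `…Large` form of it): that quantifies over plane strings of
all orders including configurations that wrap the torus, and the convergence of odd-torus expectations to the limit is
not uniform over infinitely many observables — a volume threshold uniform in the string needs a QUANTITATIVE mixing
rate, i.e. kernel-level (shape (K)) input again.  So under (T) the natural terminal for a Track-A-fed EXISTENCE chain
is the infinite-volume-first route; the finite-torus seam stays with (K).

* `momentBounds6IV_of_onSides_of_hasUniqueInfiniteVolumeLimit` — class ceilings on an unbounded class `𝓣` +
  `HasUniqueInfiniteVolumeLimit r.ρ β` for `β ≥ β₀` ⇒ `MomentBounds6IV G r a` (every torus limit state, any sides).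
* `momentBounds6TL_of_onSides_of_hasUniqueInfiniteVolumeLimit` — hence `MomentBounds6TL G r a` (the infinite-volume
  route's E0′ input; the DATA states of `OSExistenceFromInfiniteVolume` are odd-torus limit points).
* `momentBounds6DLR_of_onSides_of_subsingleton` — with uniqueness of the DLR state (`(ymGibbsMeasures r.ρ β).Subsingleton`,
  stronger) even `MomentBounds6DLR G r a` (every Gibbs state, any boundary condition).

References: H.-O. Georgii, Gibbs Measures and Phase Transitions (2011) Thm. 4.17; K. Osterwalder, E. Seiler, Ann.
Phys. 110 (1978) §4; S. Chatterjee, arXiv:1803.01950 §2.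
-/

set_option autoImplicit false

noncomputable section

open MeasureTheory Filter Topology
open Literature.MathematicalPhysics.QuantumFieldTheory hiding ZdEdge
open Literature.MathematicalPhysics.QuantumLattice
open Summit.QuantumFields.YangMills.Cruxes.OSLegsFromFemtoAndGap.DlrCollarTransfer
open Summit.QuantumFields.YangMills.Cruxes.UV.TorusClass (MomentBounds6OnSides)

namespace Summit.QuantumFields.YangMills.Theorems.InfiniteVolume

variable {G : Type} [Group G] [TopologicalSpace G] [IsTopologicalGroup G] [CompactSpace G]
  [MeasurableSpace G] [BorelSpace G]

/-- **Shape (T) at the infinite-volume level.**  Ceilings on the tori of an unbounded class `𝓣` of raw sides and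
uniqueness of the thermodynamic limit for `β ≥ β₀` give the ceilings for EVERY torus limit state (`MomentBounds6IV`),
with the same constant `C` and collar `ℓ₄` (threshold `max β₄ β₀`): a limit state along `𝓣` exists by compactness
(`exists_strictMono_forall_limitAlong_of_unbounded`), carries the ceilings (`momentBounds6On_of_onSides`), and is
THE limit point. [folklore] -/
theorem momentBounds6IV_of_onSides_of_hasUniqueInfiniteVolumeLimit (r : LatticeRep G) {a : ℝ → ℝ} {𝓣 : Set ℕ}
    (β₀ : ℝ) (hU : ∀ β : ℝ, β₀ ≤ β → HasUniqueInfiniteVolumeLimit (d := 4) r.ρ β)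
    (h : MomentBounds6OnSides G r a 𝓣) (h𝓣 : ∀ m : ℕ, ∃ M ∈ 𝓣, m ≤ M) : MomentBounds6IV G r a := by
  obtain ⟨C, β₄, ℓ₄, hℓ, hC, H⟩ := momentBounds6On_of_onSides r h
  refine ⟨C, max β₄ β₀, ℓ₄, hℓ, hC, fun β hβ μ hμ n q x R hq hR hRa hsep => ?_⟩
  -- a limit state along the class at this coupling
  obtain ⟨N, hN, hN𝓣, ν, hν⟩ := exists_strictMono_forall_limitAlong_of_unbounded r (fun _ => β) h𝓣
  have hν0 : IsInfiniteVolumeLimitAlong (d := 4) r.ρ β N (ν 0) := (hν 0).2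
  -- uniqueness: both `μ` and `ν 0` are THE limit point
  obtain ⟨μβ, -, hpts⟩ := hU β (le_trans (le_max_right _ _) hβ)
  have hμ' : μ ∈ infiniteVolumeLimitPoints (d := 4) r.ρ β := hμ
  have hν' : ν 0 ∈ infiniteVolumeLimitPoints (d := 4) r.ρ β := ⟨N, hN, hν0⟩
  rw [hpts, Set.mem_singleton_iff] at hμ' hν'
  rw [hμ', ← hν']
  exact H β (le_trans (le_max_left _ _) hβ) (ν 0) ⟨N, hN, hN𝓣, hν0⟩ n q x R hq hR hRa hsep

/-- **Hence the odd-torus thermodynamic-limit ceilings `MomentBounds6TL`** — the E0′ form the infinite-volume-first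
route consumes — from class ceilings + uniqueness, with no finite-torus threshold bookkeeping. [folklore] -/
theorem momentBounds6TL_of_onSides_of_hasUniqueInfiniteVolumeLimit (r : LatticeRep G) {a : ℝ → ℝ} {𝓣 : Set ℕ}
    (β₀ : ℝ) (hU : ∀ β : ℝ, β₀ ≤ β → HasUniqueInfiniteVolumeLimit (d := 4) r.ρ β)
    (h : MomentBounds6OnSides G r a 𝓣) (h𝓣 : ∀ m : ℕ, ∃ M ∈ 𝓣, m ≤ M) : MomentBounds6TL G r a := by
  obtain ⟨C, β₄, ℓ₄, hℓ, hC, H⟩ := momentBounds6IV_of_onSides_of_hasUniqueInfiniteVolumeLimit r β₀ hU h h𝓣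
  refine ⟨C, β₄, ℓ₄, hℓ, hC, fun β hβ μ hμ => H β hβ μ ?_⟩
  -- odd-torus limit states are torus limit states (sides `2S_k + 1`)
  obtain ⟨S, hS, hμS⟩ := hμ
  exact ⟨fun k => 2 * S k, fun i j hij => Nat.mul_lt_mul_of_pos_left (hS hij) two_pos, hμS⟩

/-- **With uniqueness of the DLR state, even `MomentBounds6DLR`** (every Gibbs state of the lattice Yang–Mills
specification, any boundary condition): the limit state along the class is a DLR state (Georgii Thm. 4.17, tree
`mem_ymGibbsMeasures_of_mem_infiniteVolumeLimitPoints_holds`) and the Gibbs set is a singleton. [folklore] -/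
theorem momentBounds6DLR_of_onSides_of_subsingleton (r : LatticeRep G) {a : ℝ → ℝ} {𝓣 : Set ℕ}
    (β₀ : ℝ) (hU : ∀ β : ℝ, β₀ ≤ β → (ymGibbsMeasures (d := 4) r.ρ β).Subsingleton)
    (h : MomentBounds6OnSides G r a 𝓣) (h𝓣 : ∀ m : ℕ, ∃ M ∈ 𝓣, m ≤ M) : MomentBounds6DLR G r a := by
  haveI : SecondCountableTopology G :=
    (r.continuous.isClosedEmbedding r.injective).isEmbedding.secondCountableTopology
  haveI : T2Space G := (r.continuous.isClosedEmbedding r.injective).isEmbedding.t2Space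
  obtain ⟨C, β₄, ℓ₄, hℓ, hC, H⟩ := momentBounds6On_of_onSides r h
  refine ⟨C, max β₄ β₀, ℓ₄, hℓ, hC, fun β hβ μ hμ n q x R hq hR hRa hsep => ?_⟩
  obtain ⟨N, hN, hN𝓣, ν, hν⟩ := exists_strictMono_forall_limitAlong_of_unbounded r (fun _ => β) h𝓣
  have hν0 : IsInfiniteVolumeLimitAlong (d := 4) r.ρ β N (ν 0) := (hν 0).2
  have hνG : ν 0 ∈ ymGibbsMeasures (d := 4) r.ρ β :=
    mem_ymGibbsMeasures_of_mem_infiniteVolumeLimitPoints_holds (d := 4) (ρ := r.ρ) r.continuous ⟨N, hN, hν0⟩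
  have hμν : μ = ν 0 := hU β (le_trans (le_max_right _ _) hβ) hμ hνG
  rw [hμν]
  exact H β (le_trans (le_max_left _ _) hβ) (ν 0) ⟨N, hN, hN𝓣, hν0⟩ n q x R hq hR hRa hsep

end Summit.QuantumFields.YangMills.Theorems.InfiniteVolume

end
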